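import Summits.HodgeConjecture.CorCM.MumfordTateRankThree
import HarnessLib

/-!
# `dim MT(H¹(X)) = 3` iff `X ∼ S^{N+1}` for a simple CM surface `S`, or `X ∼ E₁^a × E₂^b` for two non-isogenous CM
# elliptic curves — the rank-`3` rung of the Mumford–Tate ladder in closed form

COR-CM (cell `pub-hodgecm2`, seat `b27` gen 29, count-neutral lane MT-RANK-THREE, file 4; theorems only, no definition, no
named fact; UNCONDITIONAL).  `CorCM/MumfordTateRankThree` proves `mtRank_hodge_one_eq_three_iff` with the right-hand side
in the tree's «family» form (`X` isogenous to `⨁_j A'_{cls j}` for simple, pairwise non-isogenous CM realisations `A'_c`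
of total dimension `2`).  This file unpacks the finite combinatorics (`Σ_c dim A'_c = 2` with every `dim A'_c ≥ 1`: one
member of dimension `2`, or two members of dimension `1`) into the two classical shapes, for EVERY complex abelian
variety `X` with `0 < dim X`:

* `mtRank_hodge_one_eq_three_iff_surface_or_elliptic` — **`dim MT(H¹(X)) = 3` iff EITHER `X ∼ S^{N+1}` for a simple
  abelian surface `S` of CM type, OR `X ∼ ∏_j E_{cls j}` (`cls : Fin (m+1) → Fin 2` onto) for two non-isogenous elliptic
  curves `E₀, E₁` with complex multiplication** (`⟸` by `mtRank_hodge_one_eq_three_of_isIsogenous_powSucc_surface` and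
  `mtRank_hodge_one_eq_card_add_one_of_isIsogenous_biproduct_elliptic`).

## References

* [MoonenZarhin1999LowDim] B. Moonen, Yu. Zarhin, *Hodge classes on abelian varieties of low dimension*, Math. Ann. 315
  (1999), §2 (Hodge groups of products of elliptic curves and of simple CM surfaces).
* [Gordon1999HodgeAVSurvey] B. B. Gordon, *A survey of the Hodge conjecture for abelian varieties* (1999), 7.4–7.7, 9.1.
* [Deligne1982HodgeCycles] P. Deligne, *Hodge cycles on abelian varieties*, LNM 900 (1982), I Ex. 3.7, Prop. 5.1.
-/

noncomputable section

open scoped TensorProduct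
open CategoryTheory CategoryTheory.Limits NumberField Module
open scoped BigOperators

namespace Summit.HodgeConjecture.CorCM

open Literature.NumberTheory.ComplexMultiplication
open Literature.AlgebraicGeometry.Motives
open Literature.AlgebraicGeometry.Motives.AbelianVariety
open Literature.AlgebraicGeometry.Motives.HodgeStructure
open Literature.AlgebraicGeometry.HodgeTheory
open Literature.AlgebraicGeometry.ComplexMultiplication (IsCMTypeRealisation)
open Literature.AlgebraicGeometry.Milne1999 (IsOfCMType)
open Literature.AlgebraicGeometry.Pohlmann1968

variable [HodgeTensorFacts.{0, 0}] {X : AbelianVariety ℂ} {n : ℕ}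

omit [HodgeTensorFacts.{0, 0}] in
/-- A realisation of a CM type has positive dimension (`[K:ℚ] = 2 dim A ≥ 1`). [cite: Shimura1998, §5.2 (pp. 36–37)] -/
private theorem dim_pos_of_isCMTypeRealisation {K : Type} [Field K] [NumberField K] {Φ : CMType K}
    {A : AbelianVariety ℂ} {ι : 𝓞 K →+* End A} {θ : K →+* Module.End ℂ (complexBetti A.X 1)}
    (hA : IsCMTypeRealisation Φ A ι θ) : 0 < A.dim := by
  have h := finrank_eq_two_mul_dim_of_isCMTypeRealisation hA
  have hpos : 0 < Module.finrank ℚ K := Module.finrank_pos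
  omega

/-- **The rank-`3` rung in closed form.**  For a complex abelian variety `X` with `0 < dim X`:
`dim MT(H¹(X)) = 3` iff EITHER `X` is isogenous to a power `S^{N+1}` of a SIMPLE abelian SURFACE `S` of CM type, OR `X` is
isogenous to a product `⨁_j E_{cls j}` of copies of TWO non-isogenous ELLIPTIC CURVES `E₀, E₁` with complex multiplication,
each occurring (`cls : Fin (m+1) → Fin 2` surjective).  (`dim MT = 2` is the case of ONE CM elliptic curve,
`mtRank_hodge_one_eq_two_iff`; `dim MT ≤ 3` forces CM, `isOfCMType_of_mtRank_hodge_one_le_three`.)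
[cite: MoonenZarhin1999LowDim, §2] [cite: Gordon1999HodgeAVSurvey, 7.4–7.7] [cite: Deligne1982HodgeCycles, I Ex. 3.7 and Prop. 5.1] -/
theorem mtRank_hodge_one_eq_three_iff_surface_or_elliptic (hX : IsSmoothProjective n X.X) (h0 : 0 < X.dim) :
    haveI := BettiUniverse.finite hX 1
    (BettiUniverse.hodge exists_isReal_hodgeModel_holds hX 1).mtRank = 3 ↔
      (∃ S : AbelianVariety ℂ, S.IsSimple ∧ S.dim = 2 ∧ IsOfCMType S ∧ ∃ N : ℕ, IsIsogenous X (S.powSucc N)) ∨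
      (∃ E : Fin 2 → AbelianVariety ℂ, (∀ i, (E i).dim = 1) ∧ (∀ i, IsOfCMType (E i)) ∧ ¬ IsIsogenous (E 0) (E 1) ∧
        ∃ (m : ℕ) (cls : Fin (m + 1) → Fin 2), Function.Surjective cls ∧ IsIsogenous X (⨁ fun j => E (cls j))) := by
  classical
  haveI := BettiUniverse.finite hX 1
  constructor
  · intro h3
    obtain ⟨C, hC, K', hK₁, hK₂, hK₃, Φ', A', ι', θ', m, cls, f, hA, hs, hniso, hcls, hf, hsum⟩ :=
      (mtRank_hodge_one_eq_three_iff hX h0).1 h3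
    have hpos : ∀ c, 0 < (A' c).dim := fun c => dim_pos_of_isCMTypeRealisation (hA c)
    -- each member has dimension `≤ 2`, two distinct members have total dimension `≤ 2`
    have hsingle : ∀ c, (A' c).dim ≤ 2 := fun c =>
      hsum ▸ Finset.single_le_sum (f := fun x => (A' x).dim) (fun _ _ => Nat.zero_le _) (Finset.mem_univ c)
    have hpair : ∀ c c', c ≠ c' → (A' c).dim + (A' c').dim ≤ 2 := fun c c' hcc' =>
      hsum ▸ Finset.add_le_sum (f := fun x => (A' x).dim) (fun _ _ => Nat.zero_le _) (Finset.mem_univ c)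
        (Finset.mem_univ c') hcc'
    by_cases h2 : ∃ c, (A' c).dim = 2
    · -- one simple CM surface, all slots equal to it
      left
      obtain ⟨c, hc⟩ := h2
      have hall : ∀ c', c' = c := by
        intro c'
        by_contra hne
        have := hpair c c' (Ne.symm hne)
        have := hpos c'
        omega
      have hfam : (fun j => A' (cls j)) = fun _ : Fin (m + 1) => A' c := funext fun j => by rw [hall (cls j)]
      have hXB : IsIsogenous X (⨁ fun _ : Fin (m + 1) => A' c) := by
        have h : IsIsogenous X (⨁ fun j => A' (cls j)) := ⟨f, hf⟩
        rw [hfam] at h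
        exact h
      exact ⟨A' c, hs c, hc, isOfCMType_of_isCMTypeRealisation (hA c), m,
        hXB.trans (isIsogenous_powSucc_biproduct (A' c) m).symm'⟩
    · -- two non-isogenous CM elliptic curves
      right
      push Not at h2
      have hone : ∀ c, (A' c).dim = 1 := by
        intro c
        have := hsingle c
        have := hpos c
        have := h2 c
        omega
      have hcard : Fintype.card C = 2 := by
        have h := hsum
        simp_rw [hone] at h
        simpa using h
      obtain ⟨c₀, c₁, hne, huniv⟩ := Finset.card_eq_two.1 (show (Finset.univ : Finset C).card = 2 by
        rw [Finset.card_univ, hcard])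
      have hmem : ∀ c, c = c₀ ∨ c = c₁ := fun c => by
        have h : c ∈ (Finset.univ : Finset C) := Finset.mem_univ c
        rw [huniv, Finset.mem_insert, Finset.mem_singleton] at h
        exact h
      let E : Fin 2 → AbelianVariety ℂ := ![A' c₀, A' c₁]
      let cls' : Fin (m + 1) → Fin 2 := fun j => if cls j = c₀ then 0 else 1
      have hEcls : ∀ j, A' (cls j) = E (cls' j) := by
        intro j
        rcases hmem (cls j) with h | h
        · simp [E, cls', h]
        · simp [E, cls', h, hne.symm]
      have hfam : (fun j => A' (cls j)) = fun j => E (cls' j) := funext hEcls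
      have hXB : IsIsogenous X (⨁ fun j => E (cls' j)) := by
        have h : IsIsogenous X (⨁ fun j => A' (cls j)) := ⟨f, hf⟩
        rw [hfam] at h
        exact h
      have hsurj : Function.Surjective cls' := by
        intro i
        fin_cases i
        · obtain ⟨j, hj⟩ := hcls c₀
          exact ⟨j, by simp [cls', hj]⟩
        · obtain ⟨j, hj⟩ := hcls c₁
          exact ⟨j, by simp [cls', hj, hne.symm]⟩
      refine ⟨E, fun i => ?_, fun i => ?_, ?_, m, cls', hsurj, hXB⟩
      · fin_cases i
        · exact hone c₀
        · exact hone c₁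
      · fin_cases i
        · exact isOfCMType_of_isCMTypeRealisation (hA c₀)
        · exact isOfCMType_of_isCMTypeRealisation (hA c₁)
      · exact hniso c₀ c₁ hne
  · rintro (⟨S, hS, hS2, hScm, N, hXS⟩ | ⟨E, hE1, hEcm, hniso, m, cls, hcls, hXE⟩)
    · exact mtRank_hodge_one_eq_three_of_isIsogenous_powSucc_surface hX hS hS2 hScm hXS
    · have hniso' : ∀ i i' : Fin 2, i ≠ i' → ¬ IsIsogenous (E i) (E i') := by
        intro i i' hii' h
        fin_cases i <;> fin_cases i'
        · exact hii' rfl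
        · exact hniso h
        · exact hniso h.symm'
        · exact hii' rfl
      have h := mtRank_hodge_one_eq_card_add_one_of_isIsogenous_biproduct_elliptic hE1 hEcm hniso' hcls hX hXE
      rw [Fintype.card_fin] at h
      exact h

end Summit.HodgeConjecture.CorCM

end
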